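import Summits.Ventures.HSemireg.WedgeHankelRecurrenceGaussChebyshevFibonacciValues

/-!
# Venture HSemireg — **THE VIETA–LUCAS POLYNOMIALS AT A SQUARE ROOT OF `−1`: in every commutative ring, if `x² = −1` then `S_n(x) = xⁿ F_{n+1}` and `C_n(x) = xⁿ L_n` (`L_n = 2F_{n+1} − F_n`); over `ℂ`:
# `S_n(i) = iⁿ F_{n+1}`, `C_n(i) = iⁿ L_n`, and the trigonometric product `F_{n+1}² = ∏_{k=1}^{n} (1 + 4cos²(kπ∕(n+1)))`** (the Fibonacci polynomials are `i^{−n} U_n(ix∕2)`; norm-square of the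
# real factorisation `S_n = ∏ (X − 2cos(kπ∕(n+1)))` of N500 at `X = i`)

HONEST FRAMING. Part of the Lean index of the computation cell `pub-hsemireg` (seat p10 gen 49, Sunday typer «UNIFORM-IN-n»).  Polynomial algebra over a commutative ring (Mathlib
`Polynomial.Chebyshev.S ∕ C`, `Nat.fib`) and `Complex.normSq` of the real product of N500; no variety, no cohomology theory, no sheaf, no Ext group and no semiregularity map is constructed here; nothing
here says that HC / HC_CM / HC_AV holds; no Literature fact (unproved `Prop`) is declared or used.  Custodian versions as in `WedgeHankelSiegelIdeal` (1/3).
SOURCES (cited).  T. Koshy, *Fibonacci and Lucas Numbers with Applications* (Wiley 2001), Ch. 37–38 (Fibonacci polynomials `f_{n+1}(x) = i^{−n} U_n(ix∕2)`, hence `F_{n+1} = i^{−n} U_n(i∕2)`,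
`L_n = 2 i^{−n} T_n(i∕2)`); N. Garnier, O. Ramaré, *Fibonacci numbers and trigonometric identities*, Fibonacci Quart. 46∕47 (2008∕09) 56–61 (`F_n = ∏_{k=1}^{⌊(n−1)∕2⌋} (1 + 4cos²(kπ∕n))`; the
square form below is the unpaired product over all `k`); T. J. Rivlin, *The Chebyshev Polynomials* (Wiley 1974), Ex. 1.5.
PROOF TYPED HERE.  (1) Two-step induction with `S_{n+2} = X S_{n+1} − S_n`, `C_{n+2} = X C_{n+1} − C_n` and `F_{n+3} = F_{n+1} + F_{n+2}`: the step is `x·x^{n+1}F_{n+2} − xⁿF_{n+1} = x^{n+2}(F_{n+2} + F_{n+1})`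
by `x² = −1`; (2) `ℂ`, `x = i`; (3) N500 `chebyshevS_eq_prod_real` mapped to `ℂ` (`map_S`, `Polynomial.map_prod`) and evaluated at `i`: `S_n(i) = ∏ (i − 2cos θ_k)`; `Complex.normSq` is
multiplicative, `normSq(i − 2cos θ) = 1 + 4cos² θ` and `normSq(iⁿ F_{n+1}) = F_{n+1}²`.
DEDUP DISCLOSURE (`rg -n 'sq_eq_neg_one|eval Complex.I|1 \\+ 4 \\* Real.cos' Summits/Ventures/HSemireg Literature`, 2026-09-04): the only `sq_eq_neg_one` hits are the unrelated `WedgeHankelSubstitution*`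
centraliser dimensions; no Chebyshev-at-`i` value and no `F_{n+1}²` cosine product in Mathlib or the tree (N526 has `x = 3`, `x² = 5`); 0 hits for the 8 names below.

WHAT IS IN THE TREE.  N526 `fib_add_four_add_fib` (not needed), N500 `chebyshevS_eq_prod_real`; Mathlib `S_add_two`, `C_add_two`, `map_S`, `Polynomial.map_prod`, `eval_prod`, `Complex.normSq_apply`,
`Complex.normSq_I`, `Complex.normSq_natCast`, `Complex.I_sq`, `Nat.fib_add_two`, `Nat.twoStepInduction`.
THIS FILE (namespace `Summit.Ventures.HSemireg.Wedge.HankelOuter` continued; CHAINED on N526; 0 definitions):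
* §1292 **`chebyshevS_eval_of_sq_eq_neg_one`** (`S_n(x) = xⁿ F_{n+1}`), **`chebyshevC_eval_of_sq_eq_neg_one`** (`C_n(x) = xⁿ (2F_{n+1} − F_n)`), **`chebyshevS_eval_complex_I`**, **`chebyshevC_eval_complex_I`**,
  `chebyshevS_complex_eq_prod_cos` (`S_n` over `ℂ` as `∏ (X − 2cos(kπ∕(n+1)))`), `normSq_I_sub_ofReal` (`normSq(i − r) = r² + 1`), **`fib_succ_sq_eq_prod_cos`**
  (`F_{n+1}² = ∏_{k<n} (1 + 4cos²((k+1)π∕(n+1)))`), **`fib_succ_eq_sqrt_prod_cos`** (`F_{n+1} = √∏ …`).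
CAVEATS.  `L_n` is written `2F_{n+1} − F_n` (Mathlib has no `Nat.lucas`).  Nothing Ext-side.  New names only.
-/

open Module Polynomial
open scoped Matrix Polynomial

namespace Summit.Ventures.HSemireg.Wedge.HankelOuter

/-! ## §1292. `S_n` and `C_n` at a square root of `−1`; `F_{n+1}² = ∏ (1 + 4cos²(kπ∕(n+1)))` -/

/-! ### Every commutative ring: `x² = −1` -/

/-- **For `x² = −1`: `S_n(x) = xⁿ F_{n+1}`** (all `n ∈ ℕ`, every commutative ring; the Fibonacci polynomials at `1`). [Koshy 2001, Ch. 37; Rivlin 1974, Ex. 1.5; this file, §1292] -/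
theorem chebyshevS_eval_of_sq_eq_neg_one {R : Type*} [CommRing R] {x : R} (hx : x ^ 2 = -1) (n : ℕ) :
    (Polynomial.Chebyshev.S R (n : ℤ)).eval x = x ^ n * (Nat.fib (n + 1) : R) := by
  induction n using Nat.twoStepInduction with
  | zero => simp
  | one => simp
  | more n ih0 ih1 =>
    rw [show ((n + 2 : ℕ) : ℤ) = (n : ℤ) + 2 by push_cast; ring, Polynomial.Chebyshev.S_add_two, show (n : ℤ) + 1 = ((n + 1 : ℕ) : ℤ) by push_cast; ring,
      eval_sub, eval_mul, eval_X, ih0, ih1]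
    have hf : (Nat.fib (n + 2 + 1) : R) = Nat.fib (n + 1) + Nat.fib (n + 1 + 1) := by
      have h : Nat.fib (n + 2 + 1) = Nat.fib (n + 1) + Nat.fib (n + 1 + 1) := Nat.fib_add_two
      rw [h, Nat.cast_add]
    rw [hf]
    linear_combination (-(x ^ n * (Nat.fib (n + 1) : R))) * hx

/-- **For `x² = −1`: `C_n(x) = xⁿ L_n = xⁿ (2F_{n+1} − F_n)`** (all `n ∈ ℕ`, every commutative ring). [Koshy 2001, Ch. 38; this file, §1292] -/
theorem chebyshevC_eval_of_sq_eq_neg_one {R : Type*} [CommRing R] {x : R} (hx : x ^ 2 = -1) (n : ℕ) :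
    (Polynomial.Chebyshev.C R (n : ℤ)).eval x = x ^ n * (2 * (Nat.fib (n + 1) : R) - (Nat.fib n : R)) := by
  induction n using Nat.twoStepInduction with
  | zero => norm_num
  | one => norm_num
  | more n ih0 ih1 =>
    rw [show ((n + 2 : ℕ) : ℤ) = (n : ℤ) + 2 by push_cast; ring, Polynomial.Chebyshev.C_add_two, show (n : ℤ) + 1 = ((n + 1 : ℕ) : ℤ) by push_cast; ring,
      eval_sub, eval_mul, eval_X, ih0, ih1]
    have hf2 : (Nat.fib (n + 2) : R) = Nat.fib n + Nat.fib (n + 1) := by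
      have h : Nat.fib (n + 2) = Nat.fib n + Nat.fib (n + 1) := Nat.fib_add_two
      rw [h, Nat.cast_add]
    have hf3 : (Nat.fib (n + 2 + 1) : R) = Nat.fib (n + 1) + Nat.fib (n + 2) := by
      have h : Nat.fib (n + 2 + 1) = Nat.fib (n + 1) + Nat.fib (n + 2) := Nat.fib_add_two
      rw [h, Nat.cast_add]
    rw [show n + 1 + 1 = n + 2 from rfl, hf3, hf2]
    linear_combination (-(x ^ n * (2 * (Nat.fib (n + 1) : R) - (Nat.fib n : R)))) * hx

/-! ### Over `ℂ`: `x = i` -/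

/-- **`S_n(i) = iⁿ F_{n+1}`.** [Koshy 2001, Ch. 37; this file, §1292] -/
theorem chebyshevS_eval_complex_I (n : ℕ) : (Polynomial.Chebyshev.S ℂ (n : ℤ)).eval Complex.I = Complex.I ^ n * (Nat.fib (n + 1) : ℂ) :=
  chebyshevS_eval_of_sq_eq_neg_one Complex.I_sq n

/-- **`C_n(i) = iⁿ L_n = iⁿ (2F_{n+1} − F_n)`.** [Koshy 2001, Ch. 38; this file, §1292] -/
theorem chebyshevC_eval_complex_I (n : ℕ) : (Polynomial.Chebyshev.C ℂ (n : ℤ)).eval Complex.I = Complex.I ^ n * (2 * (Nat.fib (n + 1) : ℂ) - (Nat.fib n : ℂ)) :=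
  chebyshevC_eval_of_sq_eq_neg_one Complex.I_sq n

/-! ### `F_{n+1}² = ∏ (1 + 4cos²(kπ∕(n+1)))` -/

/-- `S_n` over `ℂ` factors as `∏_{k<n} (X − 2cos((k+1)π∕(n+1)))` (N500 mapped along `ℝ → ℂ`). [this file, §1292] -/
theorem chebyshevS_complex_eq_prod_cos (n : ℕ) :
    Polynomial.Chebyshev.S ℂ (n : ℤ) = ∏ k ∈ Finset.range n, (X - Polynomial.C ((2 * Real.cos ((k + 1) * Real.pi / (n + 1)) : ℝ) : ℂ)) := by
  have h := congrArg (Polynomial.map (algebraMap ℝ ℂ)) (chebyshevS_eq_prod_real n)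
  rw [Polynomial.Chebyshev.map_S, Polynomial.map_prod] at h
  exact h.trans (Finset.prod_congr rfl fun k _ => by simp)

/-- `normSq(i − r) = r² + 1` for real `r`. [this file, §1292] -/
theorem normSq_I_sub_ofReal (r : ℝ) : Complex.normSq (Complex.I - (r : ℂ)) = r ^ 2 + 1 := by
  rw [Complex.normSq_apply]
  simp [sq]

/-- **`F_{n+1}² = ∏_{k<n} (1 + 4cos²((k+1)π∕(n+1)))`** (norm-square of `S_n(i) = ∏ (i − 2cos θ_k) = iⁿ F_{n+1}`). [Garnier–Ramaré 2008; Koshy 2001, Ch. 37; this file, §1292] -/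
theorem fib_succ_sq_eq_prod_cos (n : ℕ) : ((Nat.fib (n + 1) : ℝ)) ^ 2 = ∏ k ∈ Finset.range n, (1 + 4 * Real.cos ((k + 1) * Real.pi / (n + 1)) ^ 2) := by
  have h := congrArg (fun p : ℂ[X] => Complex.normSq (p.eval Complex.I)) (chebyshevS_complex_eq_prod_cos n)
  rw [chebyshevS_eval_complex_I, eval_prod, map_mul, map_pow, Complex.normSq_I, one_pow, one_mul, Complex.normSq_natCast, map_prod] at h
  rw [sq, h]
  refine Finset.prod_congr rfl fun k _ => ?_
  rw [eval_sub, eval_X, eval_C, normSq_I_sub_ofReal]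
  ring

/-- **`F_{n+1} = √(∏_{k<n} (1 + 4cos²((k+1)π∕(n+1))))`.** [Garnier–Ramaré 2008; this file, §1292] -/
theorem fib_succ_eq_sqrt_prod_cos (n : ℕ) : (Nat.fib (n + 1) : ℝ) = Real.sqrt (∏ k ∈ Finset.range n, (1 + 4 * Real.cos ((k + 1) * Real.pi / (n + 1)) ^ 2)) := by
  rw [← fib_succ_sq_eq_prod_cos, Real.sqrt_sq (Nat.cast_nonneg _)]

end Summit.Ventures.HSemireg.Wedge.HankelOuter
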